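import Literature.AlgebraicGeometry.Resolution.ProperModelsRegModel
import HarnessLib

/-!
# Stub `stub_resOver_of_regModelAt_tmpAt` (crux stmt-ResolutionOfSingularities-0552, line `Sketch` rev. c6)

Glue stub of the skeleton `Sketch` (rev. c6) for the crux `PalterationThesis`
(stmt-ResolutionOfSingularities-0552): **the fieldwise Zariski reduction `Res_K` from
`RegModel_K` and `TMP_K`.** Over ONE field `K` (no characteristic or perfectness hypothesis),
Zariski's two problems at `K`

* `hR` — every `F/K` essentially of finite type having a proper model has a REGULAR proper model
  (`ProperModel.RegModel` sliced at `K`), and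
* `hT` — two-model patching of proper models of every such `F/K`
  (`ProperModel.TwoModelPatching` sliced at `K`)

give resolution of every reduced separated `K`-scheme of finite type. This is the fieldwise form
of `ProperModel.resolutionInChar_of_twoModelPatching_of_regModel`
(`Literature/AlgebraicGeometry/Resolution/ProperModelsRegModel.lean`), whose proof only ever uses
its global hypotheses at the fixed ground field:

* `hasResolution_properModel_of_regModelAt_tmpAt` — patch a proper model `M` with the regular
  model `U` given by `hR`; the patch `N` is regular, being `RegLe` over `U`, and `N → M` is a
  resolution (`ProperModel.Hom.hasResolution`);
* `hasResolution_projective_of_regModelAt_tmpAt` — an integral closed subscheme of projective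
  space is a proper model of its function field (`ProjModel.ofChart`);
* `stub_resOver_of_regModelAt_tmpAt` — reduction to the integral projective case
  (`exists_topologicalKrullDim_le_of_locallyOfFiniteType`, `ResolutionOverUpToDim.of_projective`).
-/

set_option linter.dupNamespace false

noncomputable section

open CategoryTheory AlgebraicGeometry
open Literature.AlgebraicGeometry.Resolution
open Literature.AlgebraicGeometry.Motives (projectiveSpace isProper_projectiveSpace IsProjectiveOver)

namespace Summit.ResolutionOfSingularities.ResolutionOfSingularities.Theorems.PalterationThesis.ZariskiPerfect

/-- **Two-model patching at `K` reduces resolution of ALL proper models over `K` to the existence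
of ONE regular model**: patch `M` with the regular model `U` given by `hR`; the patch is regular
because it is `RegLe` over a regular model, and it maps properly birationally onto `M`.
[folklore] -/
theorem hasResolution_properModel_of_regModelAt_tmpAt {K : Type} [Field K]
    (hR : ∀ (F : Type) [Field F] [Algebra K F] [Algebra.EssFiniteType K F],
      Nonempty (ProperModel K F) → ∃ N : ProperModel K F, Scheme.IsRegular N.X)
    (hT : ∀ (F : Type) [Field F] [Algebra K F] [Algebra.EssFiniteType K F],
      ∀ M₁ M₂ : ProperModel K F,
        ∃ (N : ProperModel K F) (φ₁ : N.Hom M₁) (φ₂ : N.Hom M₂), φ₁.RegLe ∧ φ₂.RegLe)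
    {F : Type} [Field F] [Algebra K F] [Algebra.EssFiniteType K F] (M : ProperModel K F) :
    Scheme.HasResolution M.X := by
  -- adapted from `ProperModel.hasResolution_of_twoModelPatching_of_regModel`
  -- (ProperModelsRegModel.lean), hypotheses sliced at the ground field `K`
  obtain ⟨U, hU⟩ := hR F ⟨M⟩
  obtain ⟨N, φ₁, φ₂, -, h₂⟩ := hT F M U
  have hN : Scheme.IsRegular N.X := fun n => h₂ n (hU _)
  exact φ₁.hasResolution hN

/-- **Resolution of an integral projective variety over `K` from two-model patching at `K` and
ONE regular model of its function field** (no local uniformization): the variety is a proper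
model of its function field (`ProjModel.ofChart` on an affine chart around the generic point),
patched with the regular model. [folklore] -/
theorem hasResolution_projective_of_regModelAt_tmpAt {K : Type} [Field K]
    (hR : ∀ (F : Type) [Field F] [Algebra K F] [Algebra.EssFiniteType K F],
      Nonempty (ProperModel K F) → ∃ N : ProperModel K F, Scheme.IsRegular N.X)
    (hT : ∀ (F : Type) [Field F] [Algebra K F] [Algebra.EssFiniteType K F],
      ∀ M₁ M₂ : ProperModel K F,
        ∃ (N : ProperModel K F) (φ₁ : N.Hom M₁) (φ₂ : N.Hom M₂), φ₁.RegLe ∧ φ₂.RegLe)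
    {n : ℕ} (X : Scheme.{0}) [IsIntegral X]
    (ι : X ⟶ (projectiveSpace n K).left) [IsClosedImmersion ι] :
    Scheme.HasResolution X := by
  -- adapted from `ProperModel.hasResolution_of_twoModelPatching_of_regModel_projective`
  -- (ProperModelsRegModel.lean), universe specialised to `0`
  classical
  haveI : IsProper (projectiveSpace n K).hom := isProper_projectiveSpace n K
  let πX : X ⟶ Spec (.of K) := ι ≫ (projectiveSpace n K).hom
  have hproj : IsProjectiveOver (Over.mk πX) := ⟨n, Over.homMk ι rfl, ‹_›⟩
  haveI : LocallyOfFiniteType πX := inferInstance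
  obtain ⟨_, ⟨U', hU', rfl⟩, hηU, -⟩ := X.isBasis_affineOpens.exists_subset_of_mem_open
    (Set.mem_univ (genericPoint X)) isOpen_univ
  let U : X.Opens := U'
  have hU : IsAffineOpen U := hU'
  haveI : IsAffine U := hU
  haveI : Nonempty U := ⟨⟨_, hηU⟩⟩
  let A : Type := Γ(U, ⊤)
  let g : (U : Scheme.{0}) ⟶ Spec (.of K) := U.ι ≫ πX
  let ψ : K →+* A := g.appTop.hom.comp (Scheme.ΓSpecIso (.of K)).inv.hom
  have hψ : ψ.FiniteType := by
    have h1 : g.appTop.hom.FiniteType :=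
      (HasRingHomProperty.iff_of_isAffine (P := @LocallyOfFiniteType)).mp inferInstance
    exact h1.comp (RingHom.FiniteType.of_surjective _
      (Scheme.ΓSpecIso (.of K)).symm.commRingCatIsoToRingEquiv.surjective)
  letI : Algebra K A := ψ.toAlgebra
  haveI hft : Algebra.FiniteType K A := hψ
  let F : Type := FractionRing A
  let j : Spec (.of A) ⟶ X := U.toScheme.isoSpec.inv ≫ U.ι
  have hj : j ≫ πX = Spec.map (CommRingCat.ofHom (algebraMap K A)) := by
    change (U.toScheme.isoSpec.inv ≫ U.ι) ≫ πX = Spec.map (CommRingCat.ofHom ψ)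
    rw [Category.assoc, isoSpec_inv_comp]
    rfl
  let M₀ : ProjModel K F := ProjModel.ofChart (K := F) X πX hproj A j hj
  haveI : Algebra.EssFiniteType K F := inferInstance
  exact hasResolution_properModel_of_regModelAt_tmpAt hR hT M₀.toProperModel

/-- GLUE STUB (worker A, on the composition path): over a field `K`, Zariski's two problems at
`K` — existence of a regular proper model of every function field having a proper model
(`RegModel_K`) and two-model patching of proper models (`TMP_K`) — give resolution of every
reduced separated `K`-scheme of finite type (the fieldwise form of
`ProperModel.resolutionInChar_of_twoModelPatching_of_regModel`: reduce to integral projective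
`X`, a proper model of its function field, `ProjModel.ofChart`; patch it with the regular model;
the patch is regular, being `RegLe` over a regular model, and maps properly birationally to `X`).
[folklore] -/
theorem stub_resOver_of_regModelAt_tmpAt (K : Type) [Field K]
    (hR : ∀ (F : Type) [Field F] [Algebra K F] [Algebra.EssFiniteType K F],
      Nonempty (ProperModel K F) → ∃ N : ProperModel K F, Scheme.IsRegular N.X)
    (hT : ∀ (F : Type) [Field F] [Algebra K F] [Algebra.EssFiniteType K F],
      ∀ M₁ M₂ : ProperModel K F,
        ∃ (N : ProperModel K F) (φ₁ : N.Hom M₁) (φ₂ : N.Hom M₂), φ₁.RegLe ∧ φ₂.RegLe) :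
    ∀ (X : Scheme.{0}) (f : X ⟶ Spec (.of K)),
      IsSeparated f → LocallyOfFiniteType f → QuasiCompact f → IsReduced X →
      Scheme.HasResolution X := by
  -- adapted from `ProperModel.resolutionInChar_of_twoModelPatching_of_regModel`
  -- (ProperModelsRegModel.lean), hypotheses sliced at the ground field `K`
  intro X f hs hl hq hr
  haveI : QuasiCompact f := hq
  haveI : LocallyOfFiniteType f := hl
  haveI : CompactSpace X := QuasiCompact.compactSpace_of_compactSpace f
  obtain ⟨d, hd⟩ := exists_topologicalKrullDim_le_of_locallyOfFiniteType f
  refine (ResolutionOverUpToDim.of_projective (k := K) (d := d) fun m Y ι hι hY _ => ?_)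
    X f hs hl hq hr hd
  haveI := hι
  haveI := hY
  exact hasResolution_projective_of_regModelAt_tmpAt hR hT Y ι

end Summit.ResolutionOfSingularities.ResolutionOfSingularities.Theorems.PalterationThesis.ZariskiPerfect

end
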